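import Summits.ValiantsHypothesis.ValiantsHypothesis.Theorems.LacunarySymmetroidMatrixDescartesDeepEndLaw
import Summits.ValiantsHypothesis.ValiantsHypothesis.Theorems.LacunarySymmetroidMatrixDescartesGraftLaw
import Summits.ValiantsHypothesis.ValiantsHypothesis.Theorems.LacunarySymmetroidMatrixDescartesTailGraft

/-!
# `MatrixDescartes` census — the DEEP END at `m = 2`: one far near-rank-one letter is worth `2 + M`

HONEST FRAMING.  Cell `val-V1-extremal` (engine seat val-v1x-eng-6 g4), crux `Theses.LacunarySymmetroid.MatrixDescartes`
(stmt-ValiantsHypothesis-18050).  LOWER-bound / construction bookkeeping in census (CONJECTURE-A) currency; nothing here bears on the crux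
(an upper bound at fat formats, whose window excludes `m = 2`), on `DoorA26` / `DoorA34`, or on `VP ≠ VNP`.  No definitions.  Helper mode.

THE ROW (`not_posRootLawAt_deepEnd_two`).  For `m = 2` the tree's DEEP-END LAW (`Census.DeepEnd.exists_alternating_rankOne_graft`, this seat:
a rank-one letter `μ v vᵀ` grafted at a far exponent on a `K`-letter core with an `N`-alternation certificate is worth `1 + M`, `M` = far
alternations of the adjugate form `v ⬝ᵥ adj(P) v`, which at `m = 2` is the compression `wᵀ P w`, `w = (v₁, −v₀)`) composes with the tree's
TAIL GRAFT (`TailGraft.not_posRootLawAt_of_tail_top`, val-idea-5 / val-lit-p4: a rank-one TOP letter is worth one more alternation at the same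
format): **`¬ PosRootLawAt 2 (K+1) (N + M + 1)`**, i.e. the grafted end is worth `2 + M` over the core's certificate — exactly the census
bookkeeping «deep end = m + γ» of the `m = 2` record rows (`T14 = 9 + 5`, `G18 = 13 + 5`, `C22`, `GRAFT25 = 16 + 5 + 4`), with `γ = M`.
The degenerate branch `μ = 0` of the existential is discharged by the GRAFT LAW (`Graft.exists_alternating_succ`, `+2`) and monotonicity.
[folklore] throughout.
-/

-- `Summit.ValiantsHypothesis.ValiantsHypothesis.…` repeats a component by the D-0017 layout
-- (single-conjunct summit), which the `dupNamespace` linter flags; the name is mandated.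
set_option linter.dupNamespace false

namespace Summit.ValiantsHypothesis.ValiantsHypothesis.Theorems.LacunarySymmetroidMatrixDescartes.Census.DeepEnd

open Matrix Finset Filter Topology
open scoped BigOperators
open Summit.ValiantsHypothesis.ValiantsHypothesis.Theorems.LacunarySymmetroidMatrixDescartes.Census.Graft
open Summit.ValiantsHypothesis.ValiantsHypothesis.Theorems.LacunarySymmetroidMatrixDescartes.TailGraft
open Summit.ValiantsHypothesis.ValiantsHypothesis.Theorems.MatrixDescartes.Negative (PosRootLawAt)

/-- Monotonicity of the census law in the bound. [folklore] -/
theorem posRootLawAt_mono {m K B B' : ℕ} (h : PosRootLawAt m K B) (hB : B ≤ B') : PosRootLawAt m K B' :=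
  fun d S hS => (h d S hS).trans hB

/-- Appending a larger exponent to a strictly increasing support keeps it strictly increasing. [folklore] -/
theorem strictMono_snoc {K : ℕ} {d : Fin K → ℕ} (hd : StrictMono d) {D : ℕ} (hD : ∀ l, d l < D) :
    StrictMono (Fin.snoc d D : Fin (K + 1) → ℕ) := by
  intro i j hij
  induction i using Fin.lastCases with
  | last =>
    exfalso
    exact not_lt.mpr (Fin.le_last j) hij
  | cast i =>
    induction j using Fin.lastCases with
    | last => simp only [Fin.snoc_castSucc, Fin.snoc_last]; exact hD i
    | cast j =>
      simp only [Fin.snoc_castSucc]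
      exact hd (Fin.castSucc_lt_castSucc_iff.mp hij)

/-- A scaled rank-one `2 × 2` letter is singular. [folklore] -/
theorem det_smul_vecMulVec_two (μ : ℝ) (v : Fin 2 → ℝ) : (μ • vecMulVec v v).det = 0 := by
  rw [Matrix.det_fin_two]
  simp only [Matrix.smul_apply, vecMulVec_apply, smul_eq_mul]
  ring

/-- A scaled rank-one letter `μ v vᵀ` with `μ ≠ 0`, `v ≠ 0` is nonzero. [folklore] -/
theorem smul_vecMulVec_ne_zero {m : ℕ} {μ : ℝ} (hμ : μ ≠ 0) {v : Fin m → ℝ} (hv : v ≠ 0) :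
    μ • vecMulVec v v ≠ 0 := by
  obtain ⟨i, hi⟩ := Function.ne_iff.mp hv
  intro h
  have h1 := congrFun (congrFun h i) i
  simp only [Matrix.smul_apply, vecMulVec_apply, smul_eq_mul, Matrix.zero_apply] at h1
  rcases mul_eq_zero.mp h1 with h2 | h2
  · exact hμ h2
  · exact hi (mul_self_eq_zero.mp h2)

/-- **THE DEEP END AT `m = 2` IS WORTH `2 + M`.**  Core: a `K`-letter real symmetric `2 × 2` pencil on a strictly increasing support with an
`N`-alternation certificate `τ`; `v ≠ 0`-direction data: an `M`-alternation certificate `σ` of the adjugate form `v ⬝ᵥ adj(P y) *ᵥ v`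
beyond `τ`.  Then `¬ PosRootLawAt 2 (K+1) (N + M + 1)`: `ζ_sym(2, K+1) ≥ N + M + 2`. [folklore] -/
theorem not_posRootLawAt_deepEnd_two {K N M : ℕ} (d : Fin K → ℕ) (hd : StrictMono d)
    (S : Fin K → Matrix (Fin 2) (Fin 2) ℝ) (hS : ∀ l, (S l).IsSymm)
    (τ : Fin (N + 1) → ℝ) (hτ : StrictMono τ) (hτpos : ∀ j, 0 < τ j)
    (hne : ∀ j, (∑ l, τ j ^ d l • S l).det ≠ 0)
    (halt : ∀ j : Fin N, (∑ l, τ j.castSucc ^ d l • S l).det * (∑ l, τ j.succ ^ d l • S l).det < 0)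
    (v : Fin 2 → ℝ) (σ : Fin (M + 1) → ℝ) (hσ : StrictMono σ) (hsep : τ (Fin.last N) < σ 0)
    (hune : ∀ j, v ⬝ᵥ ((∑ l, σ j ^ d l • S l).adjugate *ᵥ v) ≠ 0)
    (hualt : ∀ j : Fin M, (v ⬝ᵥ ((∑ l, σ j.castSucc ^ d l • S l).adjugate *ᵥ v)) *
      (v ⬝ᵥ ((∑ l, σ j.succ ^ d l • S l).adjugate *ᵥ v)) < 0) :
    ¬ PosRootLawAt 2 (K + 1) (N + M + 1) := by
  classical
  obtain ⟨D, μ, hD, hmono, hpos, hne', halt'⟩ :=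
    exists_alternating_rankOne_graft d S τ hτ hτpos hne halt v σ hσ hsep hune hualt
  have hv : v ≠ 0 := by
    intro h0
    apply hune 0
    rw [h0, zero_dotProduct]
  by_cases hμ : μ = 0
  · -- degenerate graft: the glued certificate is a certificate of the CORE; the graft law then gives two more
    have hcore : ∀ y : ℝ, ∑ l, y ^ (Fin.snoc d D : Fin (K + 1) → ℕ) l •
        (Fin.snoc S (μ • vecMulVec v v) : Fin (K + 1) → Matrix (Fin 2) (Fin 2) ℝ) l = ∑ l, y ^ d l • S l := by
      intro y
      rw [snoc_eval, hμ, zero_smul, smul_zero, add_zero]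
    have hne2 : ∀ j, (∑ l, (fun j : Fin (N + M + 2) =>
        if h : (j : ℕ) ≤ N then τ ⟨j, Nat.lt_succ_of_le h⟩ else σ ⟨(j : ℕ) - (N + 1), by omega⟩) j ^ d l • S l).det ≠ 0 := by
      intro j; have h := hne' j; rwa [hcore] at h
    have halt2 : ∀ j : Fin (N + M + 1),
        (∑ l, (fun j : Fin (N + M + 2) =>
          if h : (j : ℕ) ≤ N then τ ⟨j, Nat.lt_succ_of_le h⟩ else σ ⟨(j : ℕ) - (N + 1), by omega⟩) j.castSucc ^ d l • S l).det *
        (∑ l, (fun j : Fin (N + M + 2) =>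
          if h : (j : ℕ) ≤ N then τ ⟨j, Nat.lt_succ_of_le h⟩ else σ ⟨(j : ℕ) - (N + 1), by omega⟩) j.succ ^ d l • S l).det < 0 := by
      intro j; have h := halt' j; rwa [hcore, hcore] at h
    obtain ⟨d', S', τ'', -, -, hS'', hτ'', hpos'', -, halt''⟩ :=
      exists_alternating_succ (m := 2) d S hS _ hmono hpos hne2 halt2
    have h := not_posRootLawAt_of_alternating (m := 2) (by omega) d' S' hS'' τ'' hτ'' hpos'' halt''
    intro hlaw
    exact h (posRootLawAt_mono hlaw (by omega))
  · -- genuine rank-one top letter: the tail graft adds one alternation at the same format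
    have hS' : ∀ l, ((Fin.snoc S (μ • vecMulVec v v) : Fin (K + 1) → Matrix (Fin 2) (Fin 2) ℝ) l).IsSymm := by
      intro l
      refine Fin.lastCases ?_ (fun i => ?_) l
      · simp only [Fin.snoc_last]
        exact (isSymm_vecMulVec_self v).smul μ
      · simp only [Fin.snoc_castSucc]
        exact hS i
    have hlast : (Fin.snoc S (μ • vecMulVec v v) : Fin (K + 1) → Matrix (Fin 2) (Fin 2) ℝ) (Fin.last K)
        = μ • vecMulVec v v := by simp only [Fin.snoc_last]
    have hdet0 : ((Fin.snoc S (μ • vecMulVec v v) : Fin (K + 1) → Matrix (Fin 2) (Fin 2) ℝ) (Fin.last K)).det = 0 := by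
      rw [hlast]; exact det_smul_vecMulVec_two μ v
    have hne0 : (Fin.snoc S (μ • vecMulVec v v) : Fin (K + 1) → Matrix (Fin 2) (Fin 2) ℝ) (Fin.last K) ≠ 0 := by
      rw [hlast]; exact smul_vecMulVec_ne_zero hμ hv
    exact not_posRootLawAt_of_tail_top (Fin.snoc d D) _ (strictMono_snoc hd hD) hS' hdet0 hne0 _ hmono hpos hne' halt'

/-! ### The compression form: `v ⬝ᵥ adj(M) v = wᵀ M w` with `w = (v₁, −v₀)`, and the row stated with `w` -/

/-- For `2 × 2` matrices the adjugate form along `v` is the quadratic form along the rotated vector `w = (v 1, −v 0)`: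
`v ⬝ᵥ adj(M) *ᵥ v = w ⬝ᵥ M *ᵥ w`.  (So the deep-end datum is the COMPRESSION of the core to the graft letter's kernel direction.) [folklore] -/
theorem adjugate_form_two (M : Matrix (Fin 2) (Fin 2) ℝ) (v : Fin 2 → ℝ) :
    v ⬝ᵥ (M.adjugate *ᵥ v) = ![v 1, -v 0] ⬝ᵥ (M *ᵥ ![v 1, -v 0]) := by
  rw [Matrix.adjugate_fin_two]
  simp [dotProduct, mulVec, Fin.sum_univ_two]
  ring

/-- **The deep end at `m = 2`, compression form.**  Same as `not_posRootLawAt_deepEnd_two`, with the far datum stated directly as an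
`M`-alternation certificate of the compression `w ⬝ᵥ P(σ j) *ᵥ w` of the core along a direction `w` (the graft letter is then
`μ v vᵀ` with `v = (−w 1, w 0) ⊥ w`): `¬ PosRootLawAt 2 (K+1) (N + M + 1)`. [folklore] -/
theorem not_posRootLawAt_deepEnd_two_compression {K N M : ℕ} (d : Fin K → ℕ) (hd : StrictMono d)
    (S : Fin K → Matrix (Fin 2) (Fin 2) ℝ) (hS : ∀ l, (S l).IsSymm)
    (τ : Fin (N + 1) → ℝ) (hτ : StrictMono τ) (hτpos : ∀ j, 0 < τ j)
    (hne : ∀ j, (∑ l, τ j ^ d l • S l).det ≠ 0)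
    (halt : ∀ j : Fin N, (∑ l, τ j.castSucc ^ d l • S l).det * (∑ l, τ j.succ ^ d l • S l).det < 0)
    (w : Fin 2 → ℝ) (σ : Fin (M + 1) → ℝ) (hσ : StrictMono σ) (hsep : τ (Fin.last N) < σ 0)
    (hune : ∀ j, w ⬝ᵥ ((∑ l, σ j ^ d l • S l) *ᵥ w) ≠ 0)
    (hualt : ∀ j : Fin M, (w ⬝ᵥ ((∑ l, σ j.castSucc ^ d l • S l) *ᵥ w)) *
      (w ⬝ᵥ ((∑ l, σ j.succ ^ d l • S l) *ᵥ w)) < 0) :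
    ¬ PosRootLawAt 2 (K + 1) (N + M + 1) := by
  set v : Fin 2 → ℝ := ![-w 1, w 0] with hv
  have hw : ![v 1, -v 0] = w := by
    ext i; fin_cases i <;> simp [hv]
  have key : ∀ Mx : Matrix (Fin 2) (Fin 2) ℝ, v ⬝ᵥ (Mx.adjugate *ᵥ v) = w ⬝ᵥ (Mx *ᵥ w) := fun Mx => by
    rw [adjugate_form_two, hw]
  refine not_posRootLawAt_deepEnd_two d hd S hS τ hτ hτpos hne halt v σ hσ hsep (fun j => ?_) (fun j => ?_)
  · rw [key]; exact hune j
  · rw [key, key]; exact hualt j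

end Summit.ValiantsHypothesis.ValiantsHypothesis.Theorems.LacunarySymmetroidMatrixDescartes.Census.DeepEnd
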